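/-
Copyright (c) 2026 the pub-hodgecm-mathlib formalisation cell (harness21).  Prover seat hodgecm-mathlib-LH4-p05 (g0): Track A «(D-RAM) FOUR-FRAME» squad of crux H413
(dealer LH4-plan (g10) WORD #29 ∕ heir LEAD F0P3a-plan (g19) T18-07 (3): «(f) `stub_U2H_leviRow_wild` → p05», HOME census v2 §E, brick L3), 2026-09-03.
The `|2|`-free twin of ★ `UnitaryTwoEdgeStabilizerResidualDichotomyRamified` §1's residual dichotomy (F0P3a-p04 (g18), road «S3-ram»).
-/
import Literature.NumberTheory.Automorphic.UnitaryTwoEdgeStabilizerResidualDichotomyRamified   -- ★ the TAME file (shape of record): `valued_apply_dichotomy_of_mem_glInt_of_ramified (he) (h2w)` + §0 bookkeeping + the `|2|`-free transports (reused as they are)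
import Literature.NumberTheory.LocalFields.RamifiedPlaceFixedValuationParity                     -- ★ L1 p855163 (this seat): no anti-fixed unit at a place with an anti-fixed uniformiser, `|2|`-free
import HarnessLib

/-!
# The residual dichotomy in the edge stabiliser `K⁰ = U ∩ GL₂(𝒪_w)` of ramified `U(1,1)` at a place WITH AN ANTI-FIXED UNIFORMISER — `|2|_w = 1` dropped
(Tits 1979 §2.7, §3.9; Serre, *Trees* II.1.3; Serre, *Local Fields* IV §2)

Topic `NumberTheory/Automorphic`; namespace `Literature.NumberTheory.Automorphic.UnitaryGroup` (as the ★ tame file).  ONE THEOREM (no definition, no instance, no notation, no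
named fact, no `sorry`).  Cell `pub/hodgecm-mathlib`, crux H413 = `stmt-HodgeConjecture-24833` (count-neutral), Track A «(D-RAM) FOUR-FRAME», unit U2H child (f)
`stub_U2H_leviRow_wild` (LH4-p05 (g0) census v2 8155187a2585211d §B: the type-ODD port of the (e3)-♯ Levi column ★ `DepthZeroTransferHValuesLeviRamifiedModular`).

THE MATHEMATICS.  `L` CM, `w ∣ v` NON-SPLIT and RAMIFIED, carrying an anti-fixed uniformiser `θ` (`σ_w θ = −θ`, `v_w θ = exp(−1)`; every tame place, and the wild places
`L_w = L⁺_v(√(u·π))`).  For `κ ∈ U(σ_w, antidiag(1,1)) ∩ GL₂(𝒪_w)` unitarity gives `σ(κ₀₀)κ₁₀ + σ(κ₁₀)κ₀₀ = 0 = σ(κ₀₁)κ₁₁ + σ(κ₁₁)κ₀₁`, i.e. `σ(κ₀₀)κ₁₀` and `σ(κ₀₁)κ₁₁` are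
ANTI-FIXED integral elements; at such a place an anti-fixed element is never a unit (★ L1 `valued_lt_one_of_complexConj_eq_neg_of_uniformizer`: it has odd order), so
`|κ₀₀κ₁₀| < 1`, `|κ₀₁κ₁₁| < 1`, and `|det κ|_w = 1` sorts the cases exactly as in the tame file: `κ` is residually DIAGONAL or residually ANTIDIAGONAL.  The tame proof's
`σ_w ≡ id (mod 𝔪_w)` + `|2|_w = 1` step is the only line replaced.  (At the other wild type, `L_w = L⁺_v(√u)`, the dichotomy FAILS — `K⁰` is then a vertex stabiliser.)
* `valued_apply_dichotomy_of_mem_glInt_of_ramified_of_uniformizer` — binders = ★ tame VERBATIM with `(h2w)` ↦ `{θ} (hθ) (hσθ)`.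
The transports `glDiagonal_inv_mul_mul_glDiagonal_mem_glInt_of_diagType` ∕ `…'_…_of_antidiagType`, the entry predicates and `not_diagType_and_antidiagType` of the tame file carry
no `|2|` hypothesis and are reused unchanged downstream.

HONEST LABEL: HC_CM is proved only modulo the 7 printed citations (2 remaining named inputs: hLiu418 = `stmt-HodgeConjecture-24832`, h413 = `stmt-HodgeConjecture-24833`) until
rung 0 closes; this file is unconditional, asserts nothing printed and freezes no stub text.

## References
* [Tits1979] J. Tits, *Reductive groups over local fields*, PSPM 33.1 (1979), §2.7, §3.9.
* [Serre1980Trees] J.-P. Serre, *Trees* (1980), Ch. II §1.3.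
* [SerreLocalFields1979] J.-P. Serre, *Local Fields*, GTM 67 (1979), Ch. IV §2 Prop. 5.
* [Rogawski1990] J. D. Rogawski, *Automorphic Representations of Unitary Groups in Three Variables*, Ann. of Math. Stud. 123 (1990), §4.9 Lemma 4.9.3 p. 56.
-/

set_option autoImplicit false

noncomputable section

open MeasureTheory Measure Set Filter Topology NumberField IsDedekindDomain Matrix ValuativeRel
open scoped ENNReal NNReal ValuativeRel Matrix MatrixGroups

namespace Literature.NumberTheory.Automorphic.UnitaryGroup

open Literature.NumberTheory.Automorphic Literature.NumberTheory.Automorphic.HermitianLatticeTree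
open Literature.NumberTheory.LocalFields.RamifiedPlaceFixedValuationParity (valued_lt_one_of_complexConj_eq_neg_of_uniformizer)

section Place

variable (L : Type) [Field L] [NumberField L] [IsCMField L] {v : HeightOneSpectrum (𝓞 ↥(maximalRealSubfield L))}
  (w : PlacesOver L v) (hw : IsCMField.complexConj L • w.1 = w.1)

include hw in
/-- **THE RESIDUAL DICHOTOMY IN `K⁰` AT A RAMIFIED PLACE WITH AN ANTI-FIXED UNIFORMISER** (`|2|`-free).  For `κ ∈ U(σ_w, (Φ₂)_w) ∩ GL₂(𝒪_w)`, `w` ramified with an anti-fixed uniformiser `θ`: either `|κ₁₀|_w < 1 ∧ |κ₀₁|_w < 1`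
(residually diagonal) or `|κ₀₀|_w < 1 ∧ |κ₁₁|_w < 1` (residually antidiagonal) — unitarity for `antidiag(1,1)` (★ `mem_unitaryGroupOfForm_antidiagonal_iff_sum'`) reads
`σ(κ₀₀)κ₁₀ + σ(κ₁₀)κ₀₀ = 0 = σ(κ₀₁)κ₁₁ + σ(κ₁₁)κ₀₁`, `σ(κ₀₀)κ₁₀`, `σ(κ₀₁)κ₁₁` are anti-fixed, hence not units (★ L1 `valued_lt_one_of_complexConj_eq_neg_of_uniformizer`): `|κ₀₀κ₁₀| < 1`,
`|κ₀₁κ₁₁| < 1`, and `|det κ|_w = 1` excludes the mixed cases. [cite: Tits1979, §3.9] [cite: SerreLocalFields1979, Ch. IV §2 Prop. 5] -/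
theorem valued_apply_dichotomy_of_mem_glInt_of_ramified_of_uniformizer (he : v.asIdeal.ramificationIdx' w.1.asIdeal ≠ 1) {θ : w.1.adicCompletion L}
    (hθ : Valued.v θ = WithZero.exp (-1 : ℤ)) (hσθ : galAdicCompletionMap (L := L) (IsCMField.complexConj L) hw θ = -θ)
    (u : ↥(unitaryGroupOfForm (galAdicCompletionMap (L := L) (IsCMField.complexConj L) hw) (placeForm (Matrix.of fun i j : Fin 2 => if i.val + j.val + 1 = 2 then (1 : L) else 0) w.1))) (hu : (u : GL (Fin 2) (w.1.adicCompletion L)) ∈ glInt 2 (w.1.adicCompletion L)) :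
    (Valued.v (((u : GL (Fin 2) (w.1.adicCompletion L)) : Matrix (Fin 2) (Fin 2) (w.1.adicCompletion L)) 1 0) < 1 ∧ Valued.v (((u : GL (Fin 2) (w.1.adicCompletion L)) : Matrix (Fin 2) (Fin 2) (w.1.adicCompletion L)) 0 1) < 1) ∨
      (Valued.v (((u : GL (Fin 2) (w.1.adicCompletion L)) : Matrix (Fin 2) (Fin 2) (w.1.adicCompletion L)) 0 0) < 1 ∧ Valued.v (((u : GL (Fin 2) (w.1.adicCompletion L)) : Matrix (Fin 2) (Fin 2) (w.1.adicCompletion L)) 1 1) < 1) := by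
  have hint : ∀ i j, Valued.v (((u : GL (Fin 2) (w.1.adicCompletion L)) : Matrix (Fin 2) (Fin 2) (w.1.adicCompletion L)) i j) ≤ 1 := (coe_mem_glInt_iff_forall_v_le_one L w hw u).1 hu
  have hdet : Valued.v (((u : GL (Fin 2) (w.1.adicCompletion L)) : Matrix (Fin 2) (Fin 2) (w.1.adicCompletion L))).det = 1 := v_det_coe_eq_one_of_mem_placeForm L w hw u
  -- unitarity relations for the antidiagonal form
  have hU : (u : GL (Fin 2) (w.1.adicCompletion L)) ∈ unitaryGroupOfForm (galAdicCompletionMap (L := L) (IsCMField.complexConj L) hw) ((StdForm.antidiagonal 2).over (w.1.adicCompletion L)) := by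
    rw [← placeForm_antidiagOne]; exact u.2
  have hrel := (mem_unitaryGroupOfForm_antidiagonal_iff_sum' (galAdicCompletionMap (L := L) (IsCMField.complexConj L) hw) 2 (u : GL (Fin 2) (w.1.adicCompletion L))).1 hU
  have r0 : Fin.rev (0 : Fin 2) = 1 := by decide
  have r1 : Fin.rev (1 : Fin 2) = 0 := by decide
  have h00 : (galAdicCompletionMap (L := L) (IsCMField.complexConj L) hw) (((u : GL (Fin 2) (w.1.adicCompletion L)) : Matrix (Fin 2) (Fin 2) (w.1.adicCompletion L)) 0 0) * ((u : GL (Fin 2) (w.1.adicCompletion L)) : Matrix (Fin 2) (Fin 2) (w.1.adicCompletion L)) 1 0 + (galAdicCompletionMap (L := L) (IsCMField.complexConj L) hw) (((u : GL (Fin 2) (w.1.adicCompletion L)) : Matrix (Fin 2) (Fin 2) (w.1.adicCompletion L)) 1 0) * ((u : GL (Fin 2) (w.1.adicCompletion L)) : Matrix (Fin 2) (Fin 2) (w.1.adicCompletion L)) 0 0 = 0 := by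
    have h := hrel 0 0
    rw [Fin.sum_univ_two, r0, r1, if_neg (by decide)] at h
    exact h
  have h11 : (galAdicCompletionMap (L := L) (IsCMField.complexConj L) hw) (((u : GL (Fin 2) (w.1.adicCompletion L)) : Matrix (Fin 2) (Fin 2) (w.1.adicCompletion L)) 0 1) * ((u : GL (Fin 2) (w.1.adicCompletion L)) : Matrix (Fin 2) (Fin 2) (w.1.adicCompletion L)) 1 1 + (galAdicCompletionMap (L := L) (IsCMField.complexConj L) hw) (((u : GL (Fin 2) (w.1.adicCompletion L)) : Matrix (Fin 2) (Fin 2) (w.1.adicCompletion L)) 1 1) * ((u : GL (Fin 2) (w.1.adicCompletion L)) : Matrix (Fin 2) (Fin 2) (w.1.adicCompletion L)) 0 1 = 0 := by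
    have h := hrel 1 1
    rw [Fin.sum_univ_two, r0, r1, if_neg (by decide)] at h
    exact h
  -- `σ(a)c + σ(c)a = 0`, `a, c ∈ 𝒪_w` ⇒ `|a| < 1 ∨ |c| < 1`: `σ(a)c` is an anti-fixed integral element, hence not a unit (★ L1)
  have key : ∀ a c : (w.1.adicCompletion L), Valued.v a ≤ 1 → Valued.v c ≤ 1 → (galAdicCompletionMap (L := L) (IsCMField.complexConj L) hw) a * c + (galAdicCompletionMap (L := L) (IsCMField.complexConj L) hw) c * a = 0 → Valued.v a < 1 ∨ Valued.v c < 1 := by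
    intro a c ha hc h
    haveI : Algebra.IsQuadraticExtension ↥(maximalRealSubfield L) L := IsCMField.isQuadraticExtension L
    have hσσ : ∀ z : w.1.adicCompletion L, (galAdicCompletionMap (L := L) (IsCMField.complexConj L) hw) ((galAdicCompletionMap (L := L) (IsCMField.complexConj L) hw) z) = z :=
      fun z => Liu2021.galAdicCompletionMap_galAdicCompletionMap_self (↥(maximalRealSubfield L)) L (IsCMField.complexConj L)
        (algEquiv_mul_self_eq_one (↥(maximalRealSubfield L)) (IsCMField.complexConj_ne_one L)) hw z
    have hanti : (galAdicCompletionMap (L := L) (IsCMField.complexConj L) hw) ((galAdicCompletionMap (L := L) (IsCMField.complexConj L) hw) a * c) =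
        -((galAdicCompletionMap (L := L) (IsCMField.complexConj L) hw) a * c) := by
      rw [map_mul, hσσ, eq_neg_iff_add_eq_zero, mul_comm a, add_comm]; exact h
    have hle : Valued.v ((galAdicCompletionMap (L := L) (IsCMField.complexConj L) hw) a * c) ≤ 1 := by
      rw [Valuation.map_mul, valued_galAdicCompletionMap]; exact mul_le_one' ha hc
    have hv := valued_lt_one_of_complexConj_eq_neg_of_uniformizer L w hw he hθ hσθ hle hanti
    rw [Valuation.map_mul, valued_galAdicCompletionMap] at hv
    rcases lt_or_eq_of_le ha with ha' | ha'
    · exact Or.inl ha'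
    rcases lt_or_eq_of_le hc with hc' | hc'
    · exact Or.inr hc'
    rw [ha', hc', one_mul] at hv
    exact absurd hv (lt_irrefl _)
  have hA := key _ _ (hint 0 0) (hint 1 0) h00
  have hB := key _ _ (hint 0 1) (hint 1 1) h11
  -- `|det κ| = 1` forbids both products being small
  have hsmall : ¬ (Valued.v (((u : GL (Fin 2) (w.1.adicCompletion L)) : Matrix (Fin 2) (Fin 2) (w.1.adicCompletion L)) 0 0 * ((u : GL (Fin 2) (w.1.adicCompletion L)) : Matrix (Fin 2) (Fin 2) (w.1.adicCompletion L)) 1 1) < 1 ∧ Valued.v (((u : GL (Fin 2) (w.1.adicCompletion L)) : Matrix (Fin 2) (Fin 2) (w.1.adicCompletion L)) 0 1 * ((u : GL (Fin 2) (w.1.adicCompletion L)) : Matrix (Fin 2) (Fin 2) (w.1.adicCompletion L)) 1 0) < 1) := by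
    rintro ⟨h1, h2⟩
    have h : Valued.v (((u : GL (Fin 2) (w.1.adicCompletion L)) : Matrix (Fin 2) (Fin 2) (w.1.adicCompletion L))).det < 1 := by
      rw [Matrix.det_fin_two]; exact Valuation.map_sub_lt _ h1 h2
    rw [hdet] at h; exact lt_irrefl _ h
  rcases hA with h0 | h10
  · right
    refine ⟨h0, ?_⟩
    rcases hB with h01 | h1
    · exact absurd ⟨by rw [Valuation.map_mul]; exact mul_lt_one_of_lt_of_le h0 (hint 1 1),
        by rw [Valuation.map_mul]; exact mul_lt_one_of_lt_of_le h01 (hint 1 0)⟩ hsmall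
    · exact h1
  · left
    refine ⟨h10, ?_⟩
    rcases hB with h01 | h1
    · exact h01
    · exact absurd ⟨by rw [Valuation.map_mul, mul_comm]; exact mul_lt_one_of_lt_of_le h1 (hint 0 0),
        by rw [Valuation.map_mul, mul_comm]; exact mul_lt_one_of_lt_of_le h10 (hint 0 1)⟩ hsmall

end Place

end Literature.NumberTheory.Automorphic.UnitaryGroup

end
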